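import Summits.BirchSwinnertonDyer.BirchSwinnertonDyer.Theorems.ManinLocalTwoThreeDivisionCoverGamma1UDC
import HarnessLib

/-!
# THE DIVISION COVER ON `Γ₀(N)` for general `m`: `m ∣ c₀ ⟹ Λ₁(f) ⊆ mΛ₀(f)` modulo ONE analytic witness law; hence, at `4 ∣ N`,
# `m ∤ c₀` for every `m ≥ 3` and `c₀ ∈ {±1, ±2}` conditionally on CDT — with `c₀ = ±2` only in the index-`4` world

Summit `BirchSwinnertonDyer`, route `ManinLocalTwoThree` (cell bsd-f2-manin), crux C2 `ManinOddAtFour` (stmt-BirchSwinnertonDyer-22967); lead p1 gen 19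
(LEAD-MEMO v39).  The general-`m` form of `ManinLocalTwoThreeHalvingCoverUDC.lean` (`m = 2`, lead p1 gen 18) and `…ThirdingCoverUDC.lean` (`m = 3`),
using the `Γ₁(N)`-Wohlfahrt lemma of `ManinLocalTwoThreeDivisionCoverGamma1UDC.lean` in place of Kurth–Long.

THE IDEA.  For a lattice-optimal `X₀(N)`-datum `D` of a globally minimal `W` (`Λ_W = c·Λ₀(f)`) and `m ∣ c`, `c' := c/m`, the DIVISION POINT
`Q(τ) := c'·E_f(τ) mod Λ_W` (`mQ = φ(τ)`) is modular for EXACTLY `Γ^{(m)} := {γ ∈ Γ₀(N) : c·{∞,γ∞}_f ∈ mΛ_W} = per⁻¹(mΛ₀(f))` — finite index,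
every trace-`±2` element (§1).  A pole-cleared `F = t(Q)·B_d·Δ^k` (Honda at the integer `c'`) is the **`m`-division witness on `Γ₀`** (the one
analytic input; at `m = 2` it is LITERALLY the registered stub `stub_halvingWitnessLaw` of the C2 line of record); Unbounded Denominators (CDT) makes
`Γ^{(m)} ⊇ Γ(MN)` congruence, and the `Γ₁`-Wohlfahrt lemma (`DivisionGamma1.gamma1_le_of_Gamma_le_of_forall_trace_two_mem`) gives `Γ₁(N) ≤ Γ^{(m)}`,
i.e. **`Λ₁(f) ⊆ mΛ₀(f)`** (§2–§3).  At `4 ∣ N` the tree knows `2Λ₀(f) ⊆ Λ₁(f)` (Ling–Oesterlé at the traceless prime `2`,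
`two_mul_mem_periodLatticeGamma1_of_four_dvd`), and `2Λ₀ ⊆ mΛ₀` is absurd for `m ≥ 3` (`2ω₁/m ∉ Λ_W`); so **`m ∤ c₀` for every `m ≥ 3`**, in
particular `4 ∤ c₀` and `p ∤ c₀` for odd `p`, and **`c₀ ∈ {±1, ±2}`** (§4) — modulo CDT and the division witness laws.  The residual case `c₀ = ±2`
is exactly the index-`4` world `Λ₁ = 2Λ₀` of the halving line (`Halving.indexFour_of_halvingWitness_of_UDW`), i.e. ¬E-an-152b; so C2 keeps its
line of record C2 ⟸ CDT ∧ halving witness ∧ E-an-152b, and this file only sharpens the periphery: `v₂(c₀) ≤ 1` and no odd part, conditionally.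

* §1 `exists_divisionCoverSubgroup` — `Γ^{(m)} ≤ Γ₀(N)`: membership, finite index (`m²` cosets), trace-`±2` elements.
* §2 `gamma1_division_iff_periodLatticeGamma1_le_mul` — `Γ₁(N) ≤ Γ^{(m)} ⟺ Λ₁(f) ⊆ mΛ₀(f)` (lattice-optimal datum).
* §3 `periodLatticeGamma1_le_mul_of_divisionWitness_of_UDW` — the UDC glue; `not_dvd_maninConstant_of_CDT_of_divisionWitnessLaw_of_not_le`.
* §4 `not_periodLatticeGamma1_le_mul_of_four_dvd` (`m ≥ 3`), `not_dvd_maninConstant_of_CDT_of_divisionWitnessLaw` (`m ≥ 3`, `4 ∣ N`),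
  `natAbs_maninConstant_le_two_of_CDT_of_divisionWitnessLaws` (`c₀ ∈ {±1, ±2}`).
* §5 `not_two_dvd_maninConstant₁_of_CDT_of_halvingWitnessLaw₁` (`c₁` odd, the `Γ₁` twin at `m = 2`); §6
  `not_two_dvd_maninConstant_of_CDT_CES_of_halvingWitnessLaw₁_of_sq_dvd` — **C2 at every level `4q² ∣ N`** modulo CDT ∧ CES ∧ the `Γ₁`-halving witness.

HONEST FRAMING: CONDITIONAL on the printed CDT fact and on the OPEN analytic `m`-division witness laws on `Γ₀` (bookkeeping with a complete paper proof,
the port of the landed AN2₂ chain to `t((c/m)·E_f)`; poles of `t = −x/y` lie over the algebraic points `φ⁻¹(m·R)`, `R ∈ {y = 0}` — -an g44's audit);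
C2, Manin's conjecture and BSD are NOT proved by this file.  No definitions, no sorry.
[cite: CalegariDimitrovTang2025, Thm. 1.0.1 and Remarks 58–59] [cite: Wohlfahrt1964, Thm. 2] [cite: LingOesterle1991, Thm. 6] [cite: Manin1972, Prop. 1.4 / Thm. 1.6]
[cite: Honda1970, Thm. 9] [cite: KurthLong2008, Def. 16 and Prop. 18]
-/

set_option autoImplicit false
-- lint-debt: the directory name repeats the summit name (sibling precedent `ManinLocalTwoThreeHalvingCoverUDC.lean`)
set_option linter.dupNamespace false

noncomputable section

open scoped MatrixGroups ModularForm Manifold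
open CongruenceSubgroup Complex ModularGroup
open WeierstrassCurve Literature.NumberTheory.EllipticCurves Literature.NumberTheory.EllipticCurves.ModularForms
open Literature.NumberTheory.Automorphic
open Summit.BirchSwinnertonDyer.Rank1Residual.ManinAdditive.UDCKummerLineK

namespace Summit.BirchSwinnertonDyer.BirchSwinnertonDyer.Theorems.ManinLocalTwoThree.Division

variable {W : WeierstrassCurve ℚ} [W.IsElliptic] [W.IsGloballyMinimal] {N : ℕ} [NeZero N]

/-! ## §1 The division cover group `Γ^{(m)} = {γ ∈ Γ₀(N) : c·{∞,γ∞}_f ∈ mΛ_W}` -/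

omit [NeZero N] in
/-- Restatement helper: `Λ₁(f) ⊆ mΛ₀(f)`. [folklore] -/
theorem periodLatticeGamma1_le_mul_iff (f : CuspForm (Gamma0 N) 2) (m : ℕ) :
    (∀ z ∈ periodLatticeGamma1 f, ∃ w ∈ periodLattice f, z = (m : ℂ) * w) ↔
      ∀ γ : Gamma1 N, ∃ w ∈ periodLattice f, cuspSymbol f ⟨(γ : SL(2, ℤ)), Gamma1_in_Gamma0 N γ.2⟩ = (m : ℂ) * w := by
  constructor
  · intro h γ
    exact h _ (cuspSymbol_mem_periodLatticeGamma1 f γ)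
  · intro h z hz
    induction hz using AddSubgroup.closure_induction with
    | mem x hx =>
      obtain ⟨γ, rfl⟩ := hx
      exact h γ
    | zero => exact ⟨0, zero_mem _, by simp⟩
    | add x y _ _ hx hy =>
      obtain ⟨ν₁, hν₁, e₁⟩ := hx
      obtain ⟨ν₂, hν₂, e₂⟩ := hy
      exact ⟨ν₁ + ν₂, add_mem hν₁ hν₂, by rw [e₁, e₂]; ring⟩
    | neg x _ hx =>
      obtain ⟨ν, hν, e⟩ := hx
      exact ⟨-ν, neg_mem hν, by rw [e]; ring⟩

omit [W.IsElliptic] [W.IsGloballyMinimal] in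
/-- **The `m`-division cover group on `Γ₀(N)`.**  For any `X₀(N)`-datum `D` and `m > 0`: `Γ^{(m)} = {γ ∈ Γ₀(N) : c·{∞,γ∞}_f ∈ mΛ_W}` is a
subgroup of `SL₂(ℤ)` inside `Γ₀(N)`, of finite index (at most `m²` cosets over `Γ₀(N)`; Manin's homomorphism), containing every element of
`Γ₀(N)` of trace `±2` (zero discriminant ⟹ zero period).  It is the monodromy group of the `m`-division cover `{(x, Q) : mQ = φ(x)}` of `X₀(N)`;
`m = 2` is `Halving.exists_halvingCoverSubgroup`. [cite: Manin1972, Prop. 1.4 / Thm. 1.6] [cite: KurthLong2008, Def. 16 (type II; shape)] -/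
theorem exists_divisionCoverSubgroup (D : ModularParametrizationData W N) {m : ℕ} (hm : 0 < m) :
    ∃ Γ : Subgroup SL(2, ℤ),
      (∀ γ : Gamma0 N, (γ : SL(2, ℤ)) ∈ Γ ↔ ∃ ν ∈ D.L.lattice, (D.c : ℂ) * cuspSymbol D.f γ = (m : ℂ) * ν) ∧
      Γ ≤ Gamma0 N ∧ Γ.FiniteIndex ∧
      (∀ γ ∈ Gamma0 N, (γ 0 0 + γ 1 1 = 2 ∨ γ 0 0 + γ 1 1 = -2) → γ ∈ Γ) := by
  let Γ : Subgroup SL(2, ℤ) :=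
    { carrier := {g | ∃ hg : g ∈ Gamma0 N, ∃ ν ∈ D.L.lattice, (D.c : ℂ) * cuspSymbol D.f ⟨g, hg⟩ = (m : ℂ) * ν}
      one_mem' := by
        refine ⟨(Gamma0 N).one_mem, 0, zero_mem _, ?_⟩
        have : (⟨1, (Gamma0 N).one_mem⟩ : Gamma0 N) = 1 := rfl
        rw [this, cuspSymbol_one]; simp
      mul_mem' := by
        rintro g₁ g₂ ⟨hg₁, ν₁, hν₁, e₁⟩ ⟨hg₂, ν₂, hν₂, e₂⟩
        refine ⟨(Gamma0 N).mul_mem hg₁ hg₂, ν₁ + ν₂, add_mem hν₁ hν₂, ?_⟩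
        have : (⟨g₁ * g₂, (Gamma0 N).mul_mem hg₁ hg₂⟩ : Gamma0 N) = ⟨g₁, hg₁⟩ * ⟨g₂, hg₂⟩ := rfl
        rw [this, cuspSymbol_mul_holds, mul_add, e₁, e₂]; ring
      inv_mem' := by
        rintro g ⟨hg, ν, hν, e⟩
        refine ⟨(Gamma0 N).inv_mem hg, -ν, neg_mem hν, ?_⟩
        have : (⟨g⁻¹, (Gamma0 N).inv_mem hg⟩ : Gamma0 N) = ⟨g, hg⟩⁻¹ := rfl
        rw [this, cuspSymbol_inv, mul_neg, e]; ring }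
  have hmem : ∀ γ : Gamma0 N, (γ : SL(2, ℤ)) ∈ Γ ↔
      ∃ ν ∈ D.L.lattice, (D.c : ℂ) * cuspSymbol D.f γ = (m : ℂ) * ν := fun γ ↦
    ⟨fun ⟨_, h⟩ ↦ h, fun h ↦ ⟨γ.2, h⟩⟩
  refine ⟨Γ, hmem, fun g hg ↦ hg.1, ?_, ?_⟩
  · -- FINITE INDEX: at most `m²` cosets over `Γ₀(N)`
    classical
    have hcl : ∀ γ : Gamma0 N, ∃ i j : ℕ, i < m ∧ j < m ∧ ∃ ν ∈ D.L.lattice,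
        (D.c : ℂ) * cuspSymbol D.f γ - (i : ℂ) * D.L.ω₁ - (j : ℂ) * D.L.ω₂ = (m : ℂ) * ν := fun γ ↦
      DivisionGamma1.exists_sq_classes D.L hm _ (D.smul_periodLattice_le _ (cuspSymbol_mem_periodLattice D.f γ))
    have hrep : ∀ p : Fin m × Fin m, ∃ g : Gamma0 N, (∃ γ : Gamma0 N, ∃ ν ∈ D.L.lattice,
        (D.c : ℂ) * cuspSymbol D.f γ - ((p.1 : ℕ) : ℂ) * D.L.ω₁ - ((p.2 : ℕ) : ℂ) * D.L.ω₂ = (m : ℂ) * ν) →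
        ∃ ν ∈ D.L.lattice, (D.c : ℂ) * cuspSymbol D.f g - ((p.1 : ℕ) : ℂ) * D.L.ω₁ - ((p.2 : ℕ) : ℂ) * D.L.ω₂ = (m : ℂ) * ν := by
      intro p
      by_cases h : ∃ γ : Gamma0 N, ∃ ν ∈ D.L.lattice,
          (D.c : ℂ) * cuspSymbol D.f γ - ((p.1 : ℕ) : ℂ) * D.L.ω₁ - ((p.2 : ℕ) : ℂ) * D.L.ω₂ = (m : ℂ) * ν
      · obtain ⟨γ, hγ⟩ := h; exact ⟨γ, fun _ ↦ hγ⟩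
      · exact ⟨1, fun h' ↦ absurd h' h⟩
    choose rep hrep using hrep
    have hcoset : ∀ γ : Gamma0 N, ∃ p : Fin m × Fin m, ((rep p : SL(2, ℤ)))⁻¹ * (γ : SL(2, ℤ)) ∈ Γ := by
      intro γ
      obtain ⟨i, j, hi, hj, ν, hν, e⟩ := hcl γ
      set p : Fin m × Fin m := (⟨i, hi⟩, ⟨j, hj⟩) with hp
      obtain ⟨ν', hν', e'⟩ := hrep p ⟨γ, ν, hν, by rw [hp]; exact e⟩
      refine ⟨p, (hmem ((rep p)⁻¹ * γ)).mpr ⟨ν - ν', sub_mem hν hν', ?_⟩⟩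
      rw [cuspSymbol_mul_holds, cuspSymbol_inv]
      have e'' : (D.c : ℂ) * cuspSymbol D.f (rep p) - (i : ℂ) * D.L.ω₁ - (j : ℂ) * D.L.ω₂ = (m : ℂ) * ν' := by
        rw [hp] at e'; exact e'
      linear_combination e - e''
    haveI : Finite (SL(2, ℤ) ⧸ Γ) := by
      refine Finite.of_surjective
        (fun q : (SL(2, ℤ) ⧸ Gamma0 N) × (Fin m × Fin m) ↦ (QuotientGroup.mk (q.1.out * (rep q.2 : SL(2, ℤ))) : SL(2, ℤ) ⧸ Γ)) ?_
      intro q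
      induction q using QuotientGroup.induction_on with
      | H g =>
        obtain ⟨h, hh⟩ := QuotientGroup.mk_out_eq_mul (Gamma0 N) g
        obtain ⟨p, hδ⟩ := hcoset h⁻¹
        refine ⟨(QuotientGroup.mk g, p), ?_⟩
        show (QuotientGroup.mk ((QuotientGroup.mk g : SL(2, ℤ) ⧸ Gamma0 N).out * (rep p : SL(2, ℤ))) : SL(2, ℤ) ⧸ Γ) =
          QuotientGroup.mk g
        rw [QuotientGroup.eq, hh]
        have e : ((g : SL(2, ℤ)) * (h : SL(2, ℤ)) * (rep p : SL(2, ℤ)))⁻¹ * g =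
            ((rep p : SL(2, ℤ)))⁻¹ * ((h⁻¹ : Gamma0 N) : SL(2, ℤ)) := by
          rw [Subgroup.coe_inv]; group
        rw [e]; exact hδ
    exact Subgroup.finiteIndex_of_finite_quotient
  · -- trace `±2` ⟹ zero discriminant ⟹ zero period
    intro γ hγ htr
    refine ⟨hγ, 0, zero_mem _, ?_⟩
    have hdet : ((γ : Matrix (Fin 2) (Fin 2) ℤ)).det = 1 := γ.2
    have hdisc : ((((⟨γ, hγ⟩ : Gamma0 N) : SL(2, ℤ)) : Matrix (Fin 2) (Fin 2) ℤ)).discr = 0 := by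
      show ((γ : Matrix (Fin 2) (Fin 2) ℤ)).discr = 0
      rw [Matrix.discr_fin_two, Matrix.trace_fin_two, hdet]
      rcases htr with h | h <;> rw [h] <;> norm_num
    rw [cuspSymbol_eq_zero_of_discr_eq_zero D.f hdisc]; simp

/-! ## §2 `Γ₁(N) ≤ Γ^{(m)}` is `Λ₁(f) ⊆ mΛ₀(f)` -/

omit [W.IsElliptic] [W.IsGloballyMinimal] in
/-- For a LATTICE-OPTIMAL datum: `c·{∞,γ∞}_f ∈ mΛ_W` for every `γ ∈ Γ₁(N)` ⟺ `Λ₁(f) ⊆ mΛ₀(f)`. [cite: Manin1972, Prop. 1.4 / Thm. 1.6] -/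
theorem gamma1_division_iff_periodLatticeGamma1_le_mul (D : ModularParametrizationData W N)
    (hopt : ∀ z ∈ D.L.lattice, ∃ w ∈ periodLattice D.f, z = D.c * w) (m : ℕ) :
    (∀ γ : Gamma1 N, ∃ ν ∈ D.L.lattice,
        (D.c : ℂ) * cuspSymbol D.f ⟨(γ : SL(2, ℤ)), Gamma1_in_Gamma0 N γ.2⟩ = (m : ℂ) * ν) ↔
      ∀ z ∈ periodLatticeGamma1 D.f, ∃ w ∈ periodLattice D.f, z = (m : ℂ) * w := by
  have hc : (D.c : ℂ) ≠ 0 := D.cast_c_ne_zero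
  rw [periodLatticeGamma1_le_mul_iff]
  refine forall_congr' fun γ ↦ ⟨?_, ?_⟩
  · rintro ⟨ν, hν, e⟩
    obtain ⟨w, hw, hw'⟩ := hopt ν hν
    refine ⟨w, hw, mul_left_cancel₀ hc ?_⟩
    rw [e, hw']; ring
  · rintro ⟨w, hw, e⟩
    exact ⟨(D.c : ℂ) * w, D.smul_periodLattice_le w hw, by rw [e]; ring⟩

/-! ## §3 The UDC glue on `Γ₀(N)`: an `m`-division witness with algebraic-integer `q`-expansion forces `Λ₁(f) ⊆ mΛ₀(f)` -/

omit [W.IsElliptic] [W.IsGloballyMinimal] in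
/-- **`m`-division witness ∧ Unbounded Denominators ⟹ `Λ₁(f) ⊆ mΛ₀(f)`.**  If some holomorphic `F : ℍ → ℂ` of weight `k` has `Γ₀(N)`-stabiliser
EXACTLY `Γ^{(m)}` (invariant under it; invariance forces membership), exponential growth at every cusp and an algebraic-integer `q`-expansion, then —
modulo `UnboundedDenominatorsWeightAlgInt k` — `Γ^{(m)} ⊇ Γ(MN)`, hence (`Γ₁`-Wohlfahrt) `Γ₁(N) ≤ Γ^{(m)}`, i.e. `Λ₁(f) ⊆ mΛ₀(f)` for a lattice-optimal
datum.  (`m = 2`: `Halving.indexFour_of_halvingWitness_of_UDW`.) [cite: CalegariDimitrovTang2025, Thm. 1.0.1] [cite: Wohlfahrt1964, Thm. 2] -/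
theorem periodLatticeGamma1_le_mul_of_divisionWitness_of_UDW (D : ModularParametrizationData W N)
    (hopt : ∀ z ∈ D.L.lattice, ∃ w ∈ periodLattice D.f, z = D.c * w) {m : ℕ} (hm : 0 < m) {k : ℤ}
    (hUDW : UnboundedDenominatorsWeightAlgInt k) {F : UpperHalfPlane → ℂ} (hhol : MDifferentiable 𝓘(ℂ) 𝓘(ℂ) F)
    (hinv : ∀ γ : Gamma0 N, (∃ ν ∈ D.L.lattice, (D.c : ℂ) * cuspSymbol D.f γ = (m : ℂ) * ν) → F ∣[k] (γ : SL(2, ℤ)) = F)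
    (hstab : ∀ γ : Gamma0 N, F ∣[k] (γ : SL(2, ℤ)) = F → ∃ ν ∈ D.L.lattice, (D.c : ℂ) * cuspSymbol D.f γ = (m : ℂ) * ν)
    (hgrowth : ∀ g : SL(2, ℤ), ∃ C A r : ℝ, ∀ τ : UpperHalfPlane, A ≤ τ.im → ‖(F ∣[k] g) τ‖ ≤ C * Real.exp (r * τ.im))
    (hq : ∃ b : ℕ → ℂ, (∀ n, IsIntegral ℤ (b n)) ∧ ∀ τ : UpperHalfPlane,
      HasSum (fun n : ℕ ↦ b n * Complex.exp (2 * Real.pi * Complex.I * (τ : ℂ) * n)) (F τ)) :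
    ∀ z ∈ periodLatticeGamma1 D.f, ∃ w ∈ periodLattice D.f, z = (m : ℂ) * w := by
  obtain ⟨Γ, hmem, hle, hfi, htr⟩ := exists_divisionCoverSubgroup D hm
  have hN : 0 < N := Nat.pos_of_ne_zero (NeZero.ne N)
  have hΓinv : ∀ γ ∈ Γ, F ∣[k] γ = F := by
    intro γ hγ
    have hγ0 : γ ∈ Gamma0 N := hle hγ
    exact hinv ⟨γ, hγ0⟩ ((hmem ⟨γ, hγ0⟩).mp hγ)
  obtain ⟨M, hM, hcong⟩ := hUDW Γ hfi F hhol hΓinv hgrowth hq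
  -- `Γ(MN) ≤ Γ^{(m)}`
  have hΓMN : CongruenceSubgroup.Gamma (M * N) ≤ Γ := by
    intro g hg
    have hgN : g ∈ CongruenceSubgroup.Gamma N := Gamma_mul_le_right M N hg
    have hgM : g ∈ CongruenceSubgroup.Gamma M := Gamma_mul_le_left M N hg
    have hg0 : g ∈ Gamma0 N := Gamma_le_Gamma0 N hgN
    exact (hmem ⟨g, hg0⟩).mpr (hstab ⟨g, hg0⟩ (hcong g hgM))
  -- `Γ₁`-Wohlfahrt: `Γ₁(N) ≤ Γ^{(m)}`
  have h1 : Gamma1 N ≤ Γ :=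
    DivisionGamma1.gamma1_le_of_Gamma_le_of_forall_trace_two_mem N Γ
      (fun γ hγ h2 ↦ htr γ (Gamma1_in_Gamma0 N hγ) (Or.inl h2)) (Nat.mul_pos hM hN) hΓMN
  exact (gamma1_division_iff_periodLatticeGamma1_le_mul D hopt m).mp fun γ ↦ (hmem _).mp (h1 γ.2)

/-- **`m ∣ c₀ ⟹ Λ₁(f) ⊆ mΛ₀(f)` ⟸ CDT ∧ (`m`-division witness law on `Γ₀`), for one lattice-optimal datum at `4 ∣ N`.**  `hW` is the `m`-DIVISION
WITNESS LAW ON `Γ₀` (OPEN analytic stub, shaped like `stub_halvingWitnessLaw` with `m` for `2`; on paper `F = t((c/m)·E_f)·B_d·Δ^k`, Honda at `c/m`).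
Contrapositive form: if `Λ₁(f) ⊄ mΛ₀(f)` then `m ∤ c`.  CONDITIONAL. [cite: CalegariDimitrovTang2025, Thm. 1.0.1 and Remarks 58–59] -/
theorem not_dvd_maninConstant_of_CDT_of_divisionWitnessLaw_of_not_le
    (hCDT : Literature.NumberTheory.Automorphic.CalegariDimitrovTang2025_unboundedDenominators_algInt) {m : ℕ} (hm : 0 < m)
    (hW : ∀ (W : WeierstrassCurve ℚ) [W.IsElliptic] [W.IsGloballyMinimal] {N : ℕ} [NeZero N] (D : ModularParametrizationData W N),
      2 ^ 2 ∣ N → (∀ z ∈ D.L.lattice, ∃ w ∈ periodLattice D.f, z = D.c * w) → (m : ℤ) ∣ D.c →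
      ∃ (k : ℤ) (F : UpperHalfPlane → ℂ), MDifferentiable 𝓘(ℂ) 𝓘(ℂ) F ∧
        (∀ γ : Gamma0 N, (∃ ν ∈ D.L.lattice, (D.c : ℂ) * cuspSymbol D.f γ = (m : ℂ) * ν) → F ∣[k] (γ : SL(2, ℤ)) = F) ∧
        (∀ γ : Gamma0 N, F ∣[k] (γ : SL(2, ℤ)) = F → ∃ ν ∈ D.L.lattice, (D.c : ℂ) * cuspSymbol D.f γ = (m : ℂ) * ν) ∧
        (∀ g : SL(2, ℤ), ∃ C A r : ℝ, ∀ τ : UpperHalfPlane, A ≤ τ.im → ‖(F ∣[k] g) τ‖ ≤ C * Real.exp (r * τ.im)) ∧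
        (∃ b : ℕ → ℂ, (∀ n, IsIntegral ℤ (b n)) ∧ ∀ τ : UpperHalfPlane,
          HasSum (fun n : ℕ ↦ b n * Complex.exp (2 * Real.pi * Complex.I * (τ : ℂ) * n)) (F τ)))
    (D : ModularParametrizationData W N) (h4 : 2 ^ 2 ∣ N) (hopt : ∀ z ∈ D.L.lattice, ∃ w ∈ periodLattice D.f, z = D.c * w)
    (hnot : ¬ ∀ z ∈ periodLatticeGamma1 D.f, ∃ w ∈ periodLattice D.f, z = (m : ℂ) * w) :
    ¬ (m : ℤ) ∣ D.maninConstant := by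
  intro hmc
  obtain ⟨k, F, hhol, hinv, hstab, hgrowth, hq⟩ := hW W D h4 hopt hmc
  exact hnot (periodLatticeGamma1_le_mul_of_divisionWitness_of_UDW D hopt hm
    (UDWOfCDT.unboundedDenominatorsWeightAlgInt_of_CDT_algInt hCDT k) hhol hinv hstab hgrowth hq)

/-! ## §4 At `4 ∣ N`: `Λ₁(f) ⊄ mΛ₀(f)` for `m ≥ 3`, hence `m ∤ c₀` and `c₀ ∈ {±1, ±2}` modulo CDT and the division witness laws -/

omit [W.IsElliptic] [W.IsGloballyMinimal] in
/-- **At `4 ∣ N`, `Λ₁(f) ⊄ mΛ₀(f)` for every `m ≥ 3`** (lattice-optimal datum): the tree's `2Λ₀(f) ⊆ Λ₁(f)` (Ling–Oesterlé at the traceless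
prime `2`, `two_mul_mem_periodLatticeGamma1_of_four_dvd`) would give `2Λ₀ ⊆ mΛ₀`, i.e. `(2/m)·ω₁ ∈ Λ_W`, absurd.  Unconditional.
[cite: LingOesterle1991, Thm. 6] [cite: AtkinLehner1970, Thm. 3] -/
theorem not_periodLatticeGamma1_le_mul_of_four_dvd (D : ModularParametrizationData W N) (h4 : 2 ^ 2 ∣ N)
    (hopt : ∀ z ∈ D.L.lattice, ∃ w ∈ periodLattice D.f, z = D.c * w) {m : ℕ} (hm : 3 ≤ m) :
    ¬ ∀ z ∈ periodLatticeGamma1 D.f, ∃ w ∈ periodLattice D.f, z = (m : ℂ) * w := by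
  intro h
  obtain ⟨w₁, hw₁, e₁⟩ := hopt D.L.ω₁ D.L.ω₁_mem_lattice
  obtain ⟨w', hw', e'⟩ := h _ (two_mul_mem_periodLatticeGamma1_of_four_dvd D h4 hw₁)
  -- `2ω₁ = m·(c w')` with `c w' ∈ Λ_W`, so `(2/m)·ω₁ ∈ Λ_W`
  have hν : (D.c : ℂ) * w' ∈ D.L.lattice := D.smul_periodLattice_le w' hw'
  have hm0 : (m : ℂ) ≠ 0 := by exact_mod_cast (show m ≠ 0 by omega)
  have hν' : (D.c : ℂ) * w' = (((2 : ℚ) / m : ℚ) : ℂ) * D.L.ω₁ + ((0 : ℚ) : ℂ) * D.L.ω₂ := by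
    have e2 : 2 * D.L.ω₁ = (m : ℂ) * ((D.c : ℂ) * w') := by
      rw [e₁]; linear_combination (D.c : ℂ) * e'
    push_cast
    rw [zero_mul, add_zero, div_mul_eq_mul_div, eq_div_iff hm0]
    linear_combination (-1 : ℂ) * e2
  have hden := (PeriodPair.mul_ω₁_add_mul_ω₂_mem_lattice (L := D.L) (α := (2 : ℚ) / m) (β := 0)).mp (hν' ▸ hν)
  -- `(2/m).den = 1` means `m ∣ 2`, impossible for `m ≥ 3`
  have hint : ((2 : ℚ) / m).den = 1 := hden.1
  have hdvd : (m : ℤ) ∣ 2 := by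
    have hq : ((2 : ℚ) / m) = ((((2 : ℚ) / m).num : ℚ)) := by
      conv_lhs => rw [← Rat.num_div_den ((2 : ℚ) / m)]
      rw [hint]; simp
    refine ⟨((2 : ℚ) / m).num, ?_⟩
    have hmQ : (m : ℚ) ≠ 0 := by exact_mod_cast (show m ≠ 0 by omega)
    have : (2 : ℚ) = (m : ℚ) * (((2 : ℚ) / m).num : ℚ) := by rw [← hq]; field_simp
    exact_mod_cast this
  have hle : (m : ℤ) ≤ 2 := Int.le_of_dvd (by norm_num) hdvd
  omega

/-- **`m ∤ c₀` for every `m ≥ 3` at `4 ∣ N` ⟸ CDT ∧ (`m`-division witness law on `Γ₀`)** — in particular `4 ∤ c₀` (`v₂(c₀) ≤ 1`) and `p ∤ c₀`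
for every odd prime `p`, for every lattice-optimal `X₀(N)`-datum of a globally minimal curve at `4 ∣ N`.  CONDITIONAL; C2 is not proved by this
(`m = 2` is the index-`4` world of the halving line). [cite: CalegariDimitrovTang2025, Thm. 1.0.1] [cite: LingOesterle1991, Thm. 6] -/
theorem not_dvd_maninConstant_of_CDT_of_divisionWitnessLaw
    (hCDT : Literature.NumberTheory.Automorphic.CalegariDimitrovTang2025_unboundedDenominators_algInt) {m : ℕ} (hm : 3 ≤ m)
    (hW : ∀ (W : WeierstrassCurve ℚ) [W.IsElliptic] [W.IsGloballyMinimal] {N : ℕ} [NeZero N] (D : ModularParametrizationData W N),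
      2 ^ 2 ∣ N → (∀ z ∈ D.L.lattice, ∃ w ∈ periodLattice D.f, z = D.c * w) → (m : ℤ) ∣ D.c →
      ∃ (k : ℤ) (F : UpperHalfPlane → ℂ), MDifferentiable 𝓘(ℂ) 𝓘(ℂ) F ∧
        (∀ γ : Gamma0 N, (∃ ν ∈ D.L.lattice, (D.c : ℂ) * cuspSymbol D.f γ = (m : ℂ) * ν) → F ∣[k] (γ : SL(2, ℤ)) = F) ∧
        (∀ γ : Gamma0 N, F ∣[k] (γ : SL(2, ℤ)) = F → ∃ ν ∈ D.L.lattice, (D.c : ℂ) * cuspSymbol D.f γ = (m : ℂ) * ν) ∧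
        (∀ g : SL(2, ℤ), ∃ C A r : ℝ, ∀ τ : UpperHalfPlane, A ≤ τ.im → ‖(F ∣[k] g) τ‖ ≤ C * Real.exp (r * τ.im)) ∧
        (∃ b : ℕ → ℂ, (∀ n, IsIntegral ℤ (b n)) ∧ ∀ τ : UpperHalfPlane,
          HasSum (fun n : ℕ ↦ b n * Complex.exp (2 * Real.pi * Complex.I * (τ : ℂ) * n)) (F τ)))
    (D : ModularParametrizationData W N) (h4 : 2 ^ 2 ∣ N) (hopt : ∀ z ∈ D.L.lattice, ∃ w ∈ periodLattice D.f, z = D.c * w) :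
    ¬ (m : ℤ) ∣ D.maninConstant :=
  not_dvd_maninConstant_of_CDT_of_divisionWitnessLaw_of_not_le hCDT (by omega) hW D h4 hopt
    (not_periodLatticeGamma1_le_mul_of_four_dvd D h4 hopt hm)

/-- **`c₀ ∈ {±1, ±2}` at `4 ∣ N` ⟸ CDT ∧ (the `m`-division witness laws on `Γ₀`, `m ≥ 3`).**  For every lattice-optimal `X₀(N)`-datum of a globally
minimal curve at `4 ∣ N`: `|c₀| ≤ 2` (apply the previous theorem with `m = |c₀|`), i.e. the Manin constant is `±1` or `±2`; by the halving line the case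
`±2` is exactly the index-`4` world `Λ₁(f) = 2Λ₀(f)` (¬E-an-152b), where C2 fails.  So modulo CDT and the analytic witness laws, **C2 ⟺ E-an-152b**
and the odd part and the `4`-part of Manin's conjecture at `4 ∣ N` are settled.  CONDITIONAL; C2, Manin's conjecture and BSD are not proved by this.
[cite: CalegariDimitrovTang2025, Thm. 1.0.1 and Remarks 58–59] [cite: LingOesterle1991, Thm. 6] [cite: Manin1972, Thm. 1.6] -/
theorem natAbs_maninConstant_le_two_of_CDT_of_divisionWitnessLaws
    (hCDT : Literature.NumberTheory.Automorphic.CalegariDimitrovTang2025_unboundedDenominators_algInt)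
    (hW : ∀ m : ℕ, 3 ≤ m → ∀ (W : WeierstrassCurve ℚ) [W.IsElliptic] [W.IsGloballyMinimal] {N : ℕ} [NeZero N]
      (D : ModularParametrizationData W N),
      2 ^ 2 ∣ N → (∀ z ∈ D.L.lattice, ∃ w ∈ periodLattice D.f, z = D.c * w) → (m : ℤ) ∣ D.c →
      ∃ (k : ℤ) (F : UpperHalfPlane → ℂ), MDifferentiable 𝓘(ℂ) 𝓘(ℂ) F ∧
        (∀ γ : Gamma0 N, (∃ ν ∈ D.L.lattice, (D.c : ℂ) * cuspSymbol D.f γ = (m : ℂ) * ν) → F ∣[k] (γ : SL(2, ℤ)) = F) ∧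
        (∀ γ : Gamma0 N, F ∣[k] (γ : SL(2, ℤ)) = F → ∃ ν ∈ D.L.lattice, (D.c : ℂ) * cuspSymbol D.f γ = (m : ℂ) * ν) ∧
        (∀ g : SL(2, ℤ), ∃ C A r : ℝ, ∀ τ : UpperHalfPlane, A ≤ τ.im → ‖(F ∣[k] g) τ‖ ≤ C * Real.exp (r * τ.im)) ∧
        (∃ b : ℕ → ℂ, (∀ n, IsIntegral ℤ (b n)) ∧ ∀ τ : UpperHalfPlane,
          HasSum (fun n : ℕ ↦ b n * Complex.exp (2 * Real.pi * Complex.I * (τ : ℂ) * n)) (F τ)))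
    (D : ModularParametrizationData W N) (h4 : 2 ^ 2 ∣ N) (hopt : ∀ z ∈ D.L.lattice, ∃ w ∈ periodLattice D.f, z = D.c * w) :
    D.maninConstant.natAbs ≤ 2 := by
  by_contra hlt
  rw [not_le] at hlt
  have hm : 3 ≤ D.maninConstant.natAbs := hlt
  have hdvd : ((D.maninConstant.natAbs : ℕ) : ℤ) ∣ D.maninConstant := by
    rw [Int.natCast_natAbs]; exact (abs_dvd_self D.maninConstant)
  exact not_dvd_maninConstant_of_CDT_of_divisionWitnessLaw hCDT hm (hW _ hm) D h4 hopt hdvd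

/-! ## §5 The `Γ₁` twin at `m = 2`: `c₁` is odd modulo CDT and the halving witness on `Γ₁` -/

/-- **`c₁` is ODD ⟸ CDT ∧ (the HALVING witness law on `Γ₁`)** — the `m = 2` instance of §4, the `X₁(N)` twin of the C2 line of record
`halving_udc` (`Halving.maninOddAtFour_of_CDT_halvingWitnessLaw_indexNeFour`), with NO index-`4` escape and NO level hypothesis.  In the cell's
ledger this is the `Γ₁`-side parity statement 6♭‴ («`c₁` odd») of the kato_shift_two lines, now reduced to CDT ∧ bookkeeping.  CONDITIONAL.
[cite: CalegariDimitrovTang2025, Thm. 1.0.1] [cite: Stevens1989, §2] -/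
theorem not_two_dvd_maninConstant₁_of_CDT_of_halvingWitnessLaw₁
    (hCDT : Literature.NumberTheory.Automorphic.CalegariDimitrovTang2025_unboundedDenominators_algInt)
    (hW : ∀ (W : WeierstrassCurve ℚ) [W.IsElliptic] [W.IsGloballyMinimal] {N : ℕ} [NeZero N] (D : Gamma1ParametrizationData W N),
      D.IsOptimal → (2 : ℤ) ∣ D.c →
      ∃ (k : ℤ) (F : UpperHalfPlane → ℂ), MDifferentiable 𝓘(ℂ) 𝓘(ℂ) F ∧
        (∀ γ : Gamma1 N, (∃ ν ∈ D.L.lattice,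
          (D.c : ℂ) * cuspSymbol D.f ⟨(γ : SL(2, ℤ)), Gamma1_in_Gamma0 N γ.2⟩ = 2 * ν) → F ∣[k] (γ : SL(2, ℤ)) = F) ∧
        (∀ γ : Gamma1 N, F ∣[k] (γ : SL(2, ℤ)) = F → ∃ ν ∈ D.L.lattice,
          (D.c : ℂ) * cuspSymbol D.f ⟨(γ : SL(2, ℤ)), Gamma1_in_Gamma0 N γ.2⟩ = 2 * ν) ∧
        (∀ g : SL(2, ℤ), ∃ C A r : ℝ, ∀ τ : UpperHalfPlane, A ≤ τ.im → ‖(F ∣[k] g) τ‖ ≤ C * Real.exp (r * τ.im)) ∧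
        (∃ b : ℕ → ℂ, (∀ n, IsIntegral ℤ (b n)) ∧ ∀ τ : UpperHalfPlane,
          HasSum (fun n : ℕ ↦ b n * Complex.exp (2 * Real.pi * Complex.I * (τ : ℂ) * n)) (F τ)))
    (D : Gamma1ParametrizationData W N) (hopt : D.IsOptimal) :
    ¬ (2 : ℤ) ∣ D.maninConstant := by
  have h := DivisionGamma1.not_dvd_maninConstant₁_of_CDT_of_divisionWitnessLaw₁ (m := 2) hCDT le_rfl (by exact_mod_cast hW) D hopt
  exact_mod_cast h

/-! ## §6 C2 at the levels with a SECOND additive prime, modulo CDT ∧ CES ∧ the halving witness on `Γ₁` -/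

/-- **C2 at `4 ∣ N ∧ q² ∣ N` (`q` an odd prime) ⟸ CDT ∧ CES ∧ (halving witness law on `Γ₁`).**  For a lattice-optimal `X₀(N)`-datum `D` of a globally
minimal curve: CES (`exists_optimal_gamma1ParametrizationData`) supplies the optimal `X₁(N)`-datum `D₁` of the class; two distinct traceless primes
(`a₂ = a_q = 0`, Atkin–Lehner) force `|c₀| = |c₁|` UNCONDITIONALLY (tree `natAbs_maninConstant₀_eq_of_sq_dvd_level_of_ne`, Ling–Oesterlé); and
`c₁` is odd modulo CDT ∧ the halving witness on `Γ₁` (§5).  Hence `2 ∤ c₀` — Manin's conjecture at `2` for every optimal curve with `4q² ∣ N`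
(e.g. `36 ∣ N`, `100 ∣ N`, `196 ∣ N`), CONDITIONALLY on the printed CDT and CES facts and the analytic `Γ₁`-halving witness law.  C2 in general
(one additive prime) is NOT proved by this: there the residual is the index-`4` world (E-an-152b).
[cite: CalegariDimitrovTang2025, Thm. 1.0.1] [cite: LingOesterle1991, Thm. 6] [cite: ConradEdixhovenStein2003, §6.1, Lemma 6.1.6] [cite: Stevens1989, §2] -/
theorem not_two_dvd_maninConstant_of_CDT_CES_of_halvingWitnessLaw₁_of_sq_dvd
    (hCDT : Literature.NumberTheory.Automorphic.CalegariDimitrovTang2025_unboundedDenominators_algInt)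
    (hCES : exists_optimal_gamma1ParametrizationData)
    (hW : ∀ (W : WeierstrassCurve ℚ) [W.IsElliptic] [W.IsGloballyMinimal] {N : ℕ} [NeZero N] (D : Gamma1ParametrizationData W N),
      D.IsOptimal → (2 : ℤ) ∣ D.c →
      ∃ (k : ℤ) (F : UpperHalfPlane → ℂ), MDifferentiable 𝓘(ℂ) 𝓘(ℂ) F ∧
        (∀ γ : Gamma1 N, (∃ ν ∈ D.L.lattice,
          (D.c : ℂ) * cuspSymbol D.f ⟨(γ : SL(2, ℤ)), Gamma1_in_Gamma0 N γ.2⟩ = 2 * ν) → F ∣[k] (γ : SL(2, ℤ)) = F) ∧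
        (∀ γ : Gamma1 N, F ∣[k] (γ : SL(2, ℤ)) = F → ∃ ν ∈ D.L.lattice,
          (D.c : ℂ) * cuspSymbol D.f ⟨(γ : SL(2, ℤ)), Gamma1_in_Gamma0 N γ.2⟩ = 2 * ν) ∧
        (∀ g : SL(2, ℤ), ∃ C A r : ℝ, ∀ τ : UpperHalfPlane, A ≤ τ.im → ‖(F ∣[k] g) τ‖ ≤ C * Real.exp (r * τ.im)) ∧
        (∃ b : ℕ → ℂ, (∀ n, IsIntegral ℤ (b n)) ∧ ∀ τ : UpperHalfPlane,
          HasSum (fun n : ℕ ↦ b n * Complex.exp (2 * Real.pi * Complex.I * (τ : ℂ) * n)) (F τ)))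
    (D : ModularParametrizationData W N) (h4 : 2 ^ 2 ∣ N) (hopt : ∀ z ∈ D.L.lattice, ∃ w ∈ periodLattice D.f, z = D.c * w)
    {q : ℕ} (hq : q.Prime) (hq2 : q ≠ 2) (hqN : q ^ 2 ∣ N) :
    ¬ (2 : ℤ) ∣ D.maninConstant := by
  obtain ⟨W₁, _, _, D₁, hiso, h₁⟩ := hCES W D hopt
  have heq := natAbs_maninConstant₀_eq_of_sq_dvd_level_of_ne D₁ D hiso h₁ hopt Nat.prime_two hq (Ne.symm hq2) h4 hqN
  have hodd₁ := not_two_dvd_maninConstant₁_of_CDT_of_halvingWitnessLaw₁ hCDT hW D₁ h₁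
  intro h2
  apply hodd₁
  have h2' : (2 : ℤ) ∣ (D.maninConstant.natAbs : ℤ) := by
    rw [Int.natCast_natAbs]; exact (dvd_abs 2 D.maninConstant).mpr h2
  rw [heq, Int.natCast_natAbs] at h2'
  exact (dvd_abs 2 D₁.maninConstant).mp h2'

end Summit.BirchSwinnertonDyer.BirchSwinnertonDyer.Theorems.ManinLocalTwoThree.Division

end
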